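import Summits.ABC.IUTFork.Repair.RHAxisCK1Requirements

/-!
# R4-3 falsifier faces for card `joshi-f-ansatz` (rh4-crit-1, instrument; cell currency only)

Kernel faces used in `ROUND4/IDEAS/crit-joshi-f-ansatz-rh4-crit-1.md`:
* `no_exponent_blind_licence` (card F2 / R-J3): one licence predicate cannot serve two pilot laws at a cell where they disagree;
  bed-free instance `instF2` at the toy place `(e, m, δ, r_in, r_out, j) = (1, 5, 3, 2, 1, 2)`.
* `not_cell_of_creditFree` (crit-1 zero-credit face): a pilot of ANY law `f` read with NO credit terms (`δ = r_in = r_out = 0`)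
  licenses no label with `f j ≥ 2` as soon as `e ≤ m`; `cell_one_of_creditFree`: label 1 (where `f 1 = 1`) is licensed.
  Reading: the theta-free f-Ansatz pilot with its OWN (empty) credit row recovers only the `j = 1` cells, i.e. demand mass 0.
Nothing here is an IUT object or a Literature fact; `Cell`/`lawPow` are the claim-tagged cell-currency readings of p506542.
-/

namespace Summit.ABC.IUTFork.Repair.RH.JoshiFAnsatzFaces

open Summit.ABC.IUTFork.Repair.RH.ReqsideWeightLaws

/-- F2 / R-J3: an exponent-blind licence cannot serve two laws at a cell where they disagree. [folklore] -/
theorem no_exponent_blind_licence {f g : ℕ → ℤ} {den e m δ rin rout : ℤ} {j : ℕ}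
    (hf : Cell f den e m δ rin rout j) (hg : ¬ Cell g den e m δ rin rout j) :
    ¬ ∃ P : Prop, (P ↔ Cell f den e m δ rin rout j) ∧ (P ↔ Cell g den e m δ rin rout j) := by
  rintro ⟨P, h1, h2⟩
  exact hg (h2.mp (h1.mpr hf))

/-- Toy cell: the linear law (`lawPow 2`, κ′ = 1) is licensed at `(1, 5, 3, 2, 1, j = 2)`. [folklore] -/
theorem cell_two_toy : Cell (lawPow 2) 1 1 5 3 2 1 2 := by
  unfold Cell; rw [lawPow_two]; decide

/-- Toy cell: print's law (`lawPow 4`, κ′ = 2) is NOT licensed at the same cell. [folklore] -/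
theorem not_cell_four_toy : ¬ Cell (lawPow 4) 1 1 5 3 2 1 2 := by
  unfold Cell; rw [lawPow_four]; decide

/-- Instance of F2 at the toy cell. [folklore] -/
theorem instF2 : ¬ ∃ P : Prop, (P ↔ Cell (lawPow 2) 1 1 5 3 2 1 2) ∧ (P ↔ Cell (lawPow 4) 1 1 5 3 2 1 2) :=
  no_exponent_blind_licence cell_two_toy not_cell_four_toy

/-- ZERO-CREDIT FACE: with no credit terms (`δ = r_in = r_out = 0`, `den = 1`), a law value `f j ≥ 2` is never licensed once `0 < e ≤ m`.
[folklore] -/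
theorem not_cell_of_creditFree {f : ℕ → ℤ} {e m : ℤ} {j : ℕ} (he : 0 < e) (hem : e ≤ m) (hfj : 2 ≤ f j) :
    ¬ Cell f 1 e m 0 0 0 j := by
  unfold Cell
  intro h
  have h0 : e * ((f j * m - 1 * ((j : ℤ) * 0 + ((j : ℤ) + 1) * 0)) / (1 * e)) = e * ((f j * m) / e) := by ring_nf
  rw [h0] at h
  have h1 : e * ((f j * m) / e) + (f j * m) % e = f j * m := Int.mul_ediv_add_emod (f j * m) e
  have h2 : (f j * m) % e < e := Int.emod_lt_of_pos _ he
  have hm : 0 < m := lt_of_lt_of_le he hem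
  nlinarith [mul_le_mul_of_nonneg_right hfj hm.le]

/-- … while label 1 with `f 1 = 1` IS licensed credit-free (`e·⌊m/e⌋ ≤ m`). [folklore] -/
theorem cell_one_of_creditFree {f : ℕ → ℤ} {e m : ℤ} (he : 0 < e) (hf1 : f 1 = 1) :
    Cell f 1 e m 0 0 0 1 := by
  unfold Cell
  rw [hf1]
  have h0 : e * ((1 * m - 1 * (((1 : ℕ) : ℤ) * 0 + (((1 : ℕ) : ℤ) + 1) * 0)) / (1 * e)) = e * (m / e) := by ring_nf
  rw [h0]
  have := Int.mul_ediv_self_le (x := m) (ne_of_gt he)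
  simpa using this

end Summit.ABC.IUTFork.Repair.RH.JoshiFAnsatzFaces
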